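import Literature.Computation.Certificates.PatakiRankBoundBlocks

/-!
# An attained linear optimum of a (block) standard-form SDP is attained at an extreme point
# (Burer–Monteiro 2003 Thm. 1, after Barvinok 1995 / Pataki 1998)

Companion of `PatakiRankBoundBlocks` (Pataki 1998 Thm. 2.2 at an EXTREME point of the block feasible set
`blockFeasible A c = {S : S_ρ ⪰ 0 ∀ρ, Σ_ρ A_{iρ} • S_ρ = c_i ∀ i}`). Pataki's rank bounds are statements
about points of faces ([Pataki1998, §1]: "A convex subset `F` of `S` is called a face of `S` if
`x ∈ F, y, z ∈ S, x = ½(y + z)` implies that `y` and `z` must both be in `F`. A vertex or an extreme point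
of `S` is a face consisting of a single element."); to use the `d = 0` case at an OPTIMAL solution one
needs an optimal extreme point. [BurerMonteiro2003, §3 Thm. 1, p. 333] prints the combination: "consider
the following theorem, which was proven concurrently in Barvinok [1] and Pataki [21]: Theorem 1. If the
feasible set of (1) contains an extreme point, then there exists an optimal solution `X*` of (1) with
rank `r` satisfying the inequality `r(r+1)/2 ≤ m`." (standing assumption of [BurerMonteiro2003, §1]: the
primal optimum is attained). This file PROVES, for block tuples and a linear objective
`blockObj C S = Σ_ρ C_ρ • S_ρ`:

* `exists_mem_extremePoints_isMinOn` — if the minimum of `blockObj C` over `blockFeasible A c` is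
  attained, it is attained at an EXTREME POINT of `blockFeasible A c` (the existence half of Thm. 1; the
  feasible set lies in the pointed cone of PSD tuples, so it always "contains an extreme point" when
  nonempty and the hypothesis of Thm. 1 is automatic). The typed target
  `HubbardAlgo.P1.OptimalExtremePointExists` of cell hubbard-algo is this statement with `κ = Fin f`.
* `exists_isMinOn_sum_tri_rank_le`, `exists_isMinOn_sum_rank_mul_succ_div_two_le` — hence, with
  `PatakiRankBoundBlocks.sum_tri_rank_le_card_of_mem_extremePoints`, an attained optimum is attained by a
  feasible `S` with `Σ_ρ t(rank S_ρ) ≤ |κ|` (Thm. 1 in block form).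

THE PROOF (elementary, avoiding general face theory which Mathlib lacks): with `S₀` optimal and
`T = Σ_ρ tr S₀_ρ + 1`, the set `K = {S feasible, optimal, Σ_ρ tr S_ρ ≤ T}` is compact — closed, and
BOUNDED because a PSD block of trace `≤ T` has all entries in `[-T, T]` (`|S_ij| ≤ (S_ii + S_jj)/2 ≤ tr S`);
the total trace attains its minimum on `K` on a compact nonempty set `G`; `G` has an extreme point `X₀`
(Krein–Milman lemma, Mathlib `IsCompact.extremePoints_nonempty`); and `X₀` is extreme in the FEASIBLE set:
if `X₀ = aY + bZ` with `Y, Z` feasible, `a, b > 0`, then `Y, Z` are optimal (linear objective minimised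
at `X₀`), the shrunk points `X₀ + t(Y − X₀)`, `X₀ + t(Z − X₀)` (small `t > 0`) lie in `K` (trace near
`Σ tr X₀ ≤ T − 1`) and have `X₀` as their `(a, b)`-combination, so both are trace-minimal, i.e. in `G`,
hence equal to `X₀` — so `Y = X₀`.

Everything is PROVED; no named fact. Topology: the elementwise sup norm on matrices (scoped instance
`Matrix.Norms.Elementwise`) and the product norm on block tuples.
-/

noncomputable section

namespace Literature.Computation.Certificates.SDPOptimalExtremePoint

open Matrix Finset Set
open scoped Matrix.Norms.Elementwise
open Literature.Computation.Certificates.PatakiRankBound (tri)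
open Literature.Computation.Certificates.PatakiRankBoundBlocks (blockFeasible mem_blockFeasible_iff
  sum_tri_rank_le_card_of_mem_extremePoints sum_rank_mul_succ_div_two_le_of_mem_extremePoints)

variable {ι : Type*} [Fintype ι]
variable {nρ : ι → Type*} [∀ ρ, Fintype (nρ ρ)]
variable {κ : Type*}

/-! ## §1 The linear objective and the total trace -/

/-- The linear objective `C • S = Σ_ρ tr(C_ρ S_ρ)` of the block SDP. [cite: Pataki1998, §1 (1.1)] -/
def blockObj (C S : ∀ ρ, Matrix (nρ ρ) (nρ ρ) ℝ) : ℝ := ∑ ρ, (C ρ * S ρ).trace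

/-- The total trace `Σ_ρ tr S_ρ` (the objective `blockObj` with `C = I`). [cite: Pataki1998, §1 (1.1)] -/
def totalTrace (S : ∀ ρ, Matrix (nρ ρ) (nρ ρ) ℝ) : ℝ := ∑ ρ, (S ρ).trace

/-- `blockObj C` as an `ℝ`-linear map (plumbing). [folklore] -/
private def blockObjLin (C : ∀ ρ, Matrix (nρ ρ) (nρ ρ) ℝ) : (∀ ρ, Matrix (nρ ρ) (nρ ρ) ℝ) →ₗ[ℝ] ℝ where
  toFun := blockObj C
  map_add' S T := by
    simp only [blockObj, Pi.add_apply, Matrix.mul_add, trace_add, Finset.sum_add_distrib]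
  map_smul' a S := by
    simp only [blockObj, Pi.smul_apply, Matrix.mul_smul, trace_smul, smul_eq_mul, RingHom.id_apply,
      Finset.mul_sum]

/-- Unfolding `blockObjLin`. [folklore] -/
@[simp] private theorem blockObjLin_apply (C S : ∀ ρ, Matrix (nρ ρ) (nρ ρ) ℝ) :
    blockObjLin C S = blockObj C S := rfl

/-- `totalTrace` as an `ℝ`-linear map (plumbing). [folklore] -/
private def totalTraceLin : (∀ ρ, Matrix (nρ ρ) (nρ ρ) ℝ) →ₗ[ℝ] ℝ where
  toFun := totalTrace
  map_add' S T := by simp only [totalTrace, Pi.add_apply, trace_add, Finset.sum_add_distrib]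
  map_smul' a S := by
    simp only [totalTrace, Pi.smul_apply, trace_smul, smul_eq_mul, RingHom.id_apply, Finset.mul_sum]

/-- Unfolding `totalTraceLin`. [folklore] -/
@[simp] private theorem totalTraceLin_apply (S : ∀ ρ, Matrix (nρ ρ) (nρ ρ) ℝ) :
    totalTraceLin S = totalTrace S := rfl

/-- Additivity of the objective. [cite: Pataki1998, §1 (1.1)] -/
theorem blockObj_add (C S T : ∀ ρ, Matrix (nρ ρ) (nρ ρ) ℝ) :
    blockObj C (S + T) = blockObj C S + blockObj C T := (blockObjLin C).map_add S T

/-- Homogeneity of the objective. [cite: Pataki1998, §1 (1.1)] -/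
theorem blockObj_smul (C : ∀ ρ, Matrix (nρ ρ) (nρ ρ) ℝ) (a : ℝ) (S : ∀ ρ, Matrix (nρ ρ) (nρ ρ) ℝ) :
    blockObj C (a • S) = a * blockObj C S := (blockObjLin C).map_smul a S

/-- The objective of a difference. [cite: Pataki1998, §1 (1.1)] -/
theorem blockObj_sub (C S T : ∀ ρ, Matrix (nρ ρ) (nρ ρ) ℝ) :
    blockObj C (S - T) = blockObj C S - blockObj C T := (blockObjLin C).map_sub S T

/-- Additivity of the total trace. [cite: Pataki1998, §1 (1.1)] -/
theorem totalTrace_add (S T : ∀ ρ, Matrix (nρ ρ) (nρ ρ) ℝ) :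
    totalTrace (S + T) = totalTrace S + totalTrace T := totalTraceLin.map_add S T

/-- Homogeneity of the total trace. [cite: Pataki1998, §1 (1.1)] -/
theorem totalTrace_smul (a : ℝ) (S : ∀ ρ, Matrix (nρ ρ) (nρ ρ) ℝ) :
    totalTrace (a • S) = a * totalTrace S := totalTraceLin.map_smul a S

/-- The total trace of a difference. [cite: Pataki1998, §1 (1.1)] -/
theorem totalTrace_sub (S T : ∀ ρ, Matrix (nρ ρ) (nρ ρ) ℝ) :
    totalTrace (S - T) = totalTrace S - totalTrace T := totalTraceLin.map_sub S T

/-- Continuity of the objective `C • X` of (1.1) (a linear functional on a finite-dimensional space).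
[cite: Pataki1998, §1 (1.1)] -/
theorem continuous_blockObj (C : ∀ ρ, Matrix (nρ ρ) (nρ ρ) ℝ) : Continuous (blockObj (nρ := nρ) C) :=
  (blockObjLin C).continuous_of_finiteDimensional

/-- Continuity of the total trace (the objective of (1.1) with `C = I`). [cite: Pataki1998, §1 (1.1)] -/
theorem continuous_totalTrace : Continuous (totalTrace (nρ := nρ)) :=
  (totalTraceLin (nρ := nρ)).continuous_of_finiteDimensional

/-! ## §2 The feasible set is closed and convex; PSD blocks of bounded trace are bounded -/

section PSD

variable {m : Type*} [Fintype m]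

/-- For a real PSD matrix, `|S i j| ≤ (S i i + S j j)/2` (from `0 ≤ (eᵢ ± eⱼ)ᵀ S (eᵢ ± eⱼ)`); the
`2 × 2` principal-minor inequality behind "a trace-bounded part of the PSD cone is bounded". [folklore] -/
private theorem abs_apply_le_half_add_diag [DecidableEq m] {S : Matrix m m ℝ} (hS : S.PosSemidef) (i j : m) :
    |S i j| ≤ (S i i + S j j) / 2 := by
  have hsym : S j i = S i j := by
    have := hS.1.apply j i
    simpa using this.symm
  have hq : ∀ σ : ℝ, σ * σ = 1 → 0 ≤ S i i + S j j + 2 * σ * S i j := by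
    intro σ hσ2
    have h := hS.dotProduct_mulVec_nonneg (Pi.single i 1 + σ • Pi.single j 1)
    have hexp : star (Pi.single i 1 + σ • Pi.single j 1) ⬝ᵥ (S *ᵥ (Pi.single i 1 + σ • Pi.single j 1))
        = S i i + σ * S i j + σ * S j i + σ * σ * S j j := by
      simp only [star_trivial, mulVec_add, mulVec_smul, mulVec_single_one, add_dotProduct,
        smul_dotProduct, single_one_dotProduct, Pi.add_apply, Pi.smul_apply, Matrix.col_apply,
        smul_eq_mul]
      ring
    rw [hexp, hsym, hσ2] at h
    linarith
  have h1 := hq 1 (by norm_num)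
  have h2 := hq (-1) (by norm_num)
  rw [abs_le]
  constructor <;> linarith

/-- A diagonal entry of a real PSD matrix is at most its trace. [folklore] -/
private theorem diag_le_trace {S : Matrix m m ℝ} (hS : S.PosSemidef) (i : m) : S i i ≤ S.trace := by
  rw [trace]
  exact Finset.single_le_sum (f := fun j => S j j) (fun j _ => hS.diag_nonneg) (Finset.mem_univ i)

/-- Every entry of a real PSD matrix is bounded by the trace: `|S i j| ≤ tr S`. [folklore] -/
private theorem abs_apply_le_trace [DecidableEq m] {S : Matrix m m ℝ} (hS : S.PosSemidef) (i j : m) :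
    |S i j| ≤ S.trace := by
  have h := abs_apply_le_half_add_diag hS i j
  have hi := diag_le_trace hS i
  have hj := diag_le_trace hS j
  linarith

/-- The real PSD cone is closed (an intersection of closed half-spaces). [folklore] -/
private theorem isClosed_setOf_posSemidef : IsClosed {S : Matrix m m ℝ | S.PosSemidef} := by
  have h : {S : Matrix m m ℝ | S.PosSemidef}
      = {S | Sᵀ = S} ∩ ⋂ x : m → ℝ, {S | 0 ≤ x ⬝ᵥ (S *ᵥ x)} := by
    ext S
    simp only [Set.mem_setOf_eq, Set.mem_inter_iff, Set.mem_iInter, posSemidef_iff_dotProduct_mulVec,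
      star_trivial, Matrix.IsHermitian, conjTranspose_eq_transpose_of_trivial]
  rw [h]
  refine IsClosed.inter ?_ (isClosed_iInter fun x => ?_)
  · exact isClosed_eq (continuous_id.matrix_transpose) continuous_id
  · exact isClosed_le continuous_const
      (continuous_const.dotProduct (continuous_id.matrix_mulVec continuous_const))

end PSD

/-- The block feasible set is convex. [cite: Pataki1998, §1 (the feasible set of (1.1) is closed and convex)] -/
theorem convex_blockFeasible (A : κ → ∀ ρ, Matrix (nρ ρ) (nρ ρ) ℝ) (c : κ → ℝ) :
    Convex ℝ (blockFeasible A c) := by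
  intro S hS T hT a b ha hb hab
  refine ⟨fun ρ => ?_, fun i => ?_⟩
  · simpa using (PosSemidef.add ((hS.1 ρ).smul ha) ((hT.1 ρ).smul hb))
  · simp only [Pi.add_apply, Pi.smul_apply, Matrix.mul_add, Matrix.mul_smul, trace_add, trace_smul,
      smul_eq_mul, Finset.sum_add_distrib, ← Finset.mul_sum, hS.2 i, hT.2 i]
    rw [← add_mul, hab, one_mul]

/-- The block feasible set is closed. [cite: Pataki1998, §1 (the feasible set of (1.1) is closed and convex)] -/
theorem isClosed_blockFeasible (A : κ → ∀ ρ, Matrix (nρ ρ) (nρ ρ) ℝ) (c : κ → ℝ) :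
    IsClosed (blockFeasible A c) := by
  have h : blockFeasible A c = (⋂ ρ, {S | (S ρ).PosSemidef}) ∩ ⋂ i, {S | blockObj (A i) S = c i} := by
    ext S; simp [mem_blockFeasible_iff, blockObj, Set.mem_iInter]
  rw [h]
  refine IsClosed.inter (isClosed_iInter fun ρ => ?_) (isClosed_iInter fun i => ?_)
  · have hc : Continuous fun S : (∀ ρ, Matrix (nρ ρ) (nρ ρ) ℝ) => S ρ := continuous_apply ρ
    exact (isClosed_setOf_posSemidef (m := nρ ρ)).preimage hc
  · exact isClosed_eq (continuous_blockObj (A i)) continuous_const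

/-- A feasible tuple of total trace `≤ T` has sup norm `≤ T` (every entry of every block lies in
`[-T, T]`), so trace-bounded parts of the feasible set are bounded. [folklore] -/
private theorem norm_le_of_mem_blockFeasible [∀ ρ, DecidableEq (nρ ρ)] {A : κ → ∀ ρ, Matrix (nρ ρ) (nρ ρ) ℝ}
    {c : κ → ℝ} {S : ∀ ρ, Matrix (nρ ρ) (nρ ρ) ℝ} (hS : S ∈ blockFeasible A c) {T : ℝ}
    (hT : totalTrace S ≤ T) : ‖S‖ ≤ T := by
  have htr : ∀ ρ, 0 ≤ (S ρ).trace := fun ρ => (hS.1 ρ).trace_nonneg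
  have hT0 : 0 ≤ T := le_trans (Finset.sum_nonneg fun ρ _ => htr ρ) hT
  rw [pi_norm_le_iff_of_nonneg hT0]
  intro ρ
  rw [Matrix.norm_le_iff hT0]
  intro i j
  rw [Real.norm_eq_abs]
  calc |S ρ i j| ≤ (S ρ).trace := abs_apply_le_trace (hS.1 ρ) i j
    _ ≤ totalTrace S :=
        Finset.single_le_sum (f := fun ρ => (S ρ).trace) (fun ρ _ => htr ρ) (Finset.mem_univ ρ)
    _ ≤ T := hT

/-! ## §3 The theorem -/

/-- One-dimensional extremality: if `x = a y + b z` with `a, b > 0`, `a + b = 1` and `x ≤ y`,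
`x ≤ z`, then `y = x`. [folklore] -/
private theorem eq_of_convex_comb_of_le {x y z a b : ℝ} (ha : 0 < a) (hb : 0 < b) (hab : a + b = 1)
    (h : x = a * y + b * z) (hy : x ≤ y) (hz : x ≤ z) : y = x := by
  have e : a * (y - x) + b * (z - x) = 0 := by linear_combination -h - x * hab
  have h1 : 0 ≤ a * (y - x) := mul_nonneg ha.le (sub_nonneg.mpr hy)
  have h2 : 0 ≤ b * (z - x) := mul_nonneg hb.le (sub_nonneg.mpr hz)
  have h3 : a * (y - x) = 0 := by linarith
  rcases mul_eq_zero.mp h3 with h4 | h4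
  · exact absurd h4 ha.ne'
  · linarith

/-- **An attained linear optimum over the block feasible set is attained at an extreme point of the
feasible set** ("proven concurrently in Barvinok [1] and Pataki [21]: if the feasible set of (1) contains an
extreme point, then there exists an optimal solution `X*` of (1) with rank `r` satisfying `r(r+1)/2 ≤ m`" —
this is its first half, existence of an optimal extreme point, for block tuples; the feasible set lies in
the pointed cone of PSD tuples, so it is line-free and a nonempty optimal face has a vertex).
[cite: BurerMonteiro2003, §3 Thm. 1 (p. 333)] [cite: Pataki1998, §1 (faces, extreme points)] -/
theorem exists_mem_extremePoints_isMinOn [∀ ρ, DecidableEq (nρ ρ)]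
    {A : κ → ∀ ρ, Matrix (nρ ρ) (nρ ρ) ℝ} {c : κ → ℝ} (C : ∀ ρ, Matrix (nρ ρ) (nρ ρ) ℝ)
    (hatt : ∃ S ∈ blockFeasible A c, ∀ S' ∈ blockFeasible A c, blockObj C S ≤ blockObj C S') :
    ∃ S ∈ Set.extremePoints ℝ (blockFeasible A c),
      ∀ S' ∈ blockFeasible A c, blockObj C S ≤ blockObj C S' := by
  obtain ⟨S₀, hS₀, hopt⟩ := hatt
  -- Krein–Milman below needs local convexity of the sup-normed block space (instance search does not
  -- see through the `Matrix` type synonym; unification does).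
  haveI : LocallyConvexSpace ℝ (∀ ρ, Matrix (nρ ρ) (nρ ρ) ℝ) := NormedSpace.toLocallyConvexSpace
  -- the trace cut `K` of the optimal face: compact and containing `S₀`
  set T : ℝ := totalTrace S₀ + 1 with hTdef
  set K : Set (∀ ρ, Matrix (nρ ρ) (nρ ρ) ℝ) :=
    (blockFeasible A c ∩ {S | blockObj C S ≤ blockObj C S₀}) ∩ {S | totalTrace S ≤ T} with hK
  have hKopt : ∀ S ∈ K, ∀ S' ∈ blockFeasible A c, blockObj C S ≤ blockObj C S' :=
    fun S hS S' hS' => le_trans hS.1.2 (hopt S' hS')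
  have hS₀T : totalTrace S₀ ≤ T := by rw [hTdef]; linarith
  have hS₀K : S₀ ∈ K := ⟨⟨hS₀, (le_refl _ : blockObj C S₀ ≤ blockObj C S₀)⟩, hS₀T⟩
  have hKclosed : IsClosed K :=
    ((isClosed_blockFeasible A c).inter (isClosed_le (continuous_blockObj C) continuous_const)).inter
      (isClosed_le continuous_totalTrace continuous_const)
  have hKbdd : Bornology.IsBounded K := by
    refine (Metric.isBounded_iff_subset_closedBall (0 : ∀ ρ, Matrix (nρ ρ) (nρ ρ) ℝ)).mpr
      ⟨T, fun S hS => ?_⟩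
    rw [mem_closedBall_zero_iff]
    exact norm_le_of_mem_blockFeasible hS.1.1 hS.2
  have hKcpt : IsCompact K := Metric.isCompact_of_isClosed_isBounded hKclosed hKbdd
  -- minimise the total trace on `K`; its minimisers form a compact nonempty set `G`
  obtain ⟨S₁, hS₁K, hS₁min⟩ := hKcpt.exists_isMinOn ⟨S₀, hS₀K⟩ continuous_totalTrace.continuousOn
  set G : Set (∀ ρ, Matrix (nρ ρ) (nρ ρ) ℝ) := K ∩ {S | totalTrace S ≤ totalTrace S₁} with hG
  have hGcpt : IsCompact G := hKcpt.inter_right (isClosed_le continuous_totalTrace continuous_const)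
  have hGne : G.Nonempty := ⟨S₁, hS₁K, (le_refl _ : totalTrace S₁ ≤ totalTrace S₁)⟩
  -- Krein–Milman: `G` has an extreme point `X₀`
  obtain ⟨X₀, hX₀⟩ := hGcpt.extremePoints_nonempty hGne
  have hX₀G : X₀ ∈ G := hX₀.1
  have hX₀K : X₀ ∈ K := hX₀G.1
  have hX₀F : X₀ ∈ blockFeasible A c := hX₀K.1.1
  have hX₀S₁ : totalTrace X₀ ≤ totalTrace S₁ := hX₀G.2
  have hX₀tr : totalTrace X₀ ≤ T - 1 := by
    have h2 : totalTrace S₁ ≤ totalTrace S₀ := hS₁min hS₀K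
    rw [hTdef]; linarith
  have hX₀min : ∀ S ∈ K, totalTrace X₀ ≤ totalTrace S := fun S hS => le_trans hX₀S₁ (hS₁min hS)
  refine ⟨X₀, ?_, hKopt X₀ hX₀K⟩
  -- `X₀` is an extreme point of the feasible set: let `X₀ = a Y + b Z` with `Y, Z` feasible
  rw [mem_extremePoints_iff_left]
  refine ⟨hX₀F, fun Y hY Z hZ hseg => ?_⟩
  obtain ⟨a, b, ha, hb, hab, hcomb⟩ := hseg
  -- both endpoints are optimal (the optimal set is a face)
  have hobj : blockObj C X₀ = a * blockObj C Y + b * blockObj C Z := by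
    rw [← hcomb, blockObj_add, blockObj_smul, blockObj_smul]
  have hYobj : blockObj C Y = blockObj C X₀ :=
    eq_of_convex_comb_of_le ha hb hab hobj (hKopt X₀ hX₀K Y hY) (hKopt X₀ hX₀K Z hZ)
  have hZobj : blockObj C Z = blockObj C X₀ :=
    eq_of_convex_comb_of_le hb ha (by rw [add_comm]; exact hab) (by rw [hobj]; ring)
      (hKopt X₀ hX₀K Z hZ) (hKopt X₀ hX₀K Y hY)
  -- shrink the segment: `W ↦ X₀ + t (W - X₀)` with `t = 1 / (D + 1)`, `D` the total trace variation
  obtain ⟨D, hD⟩ : ∃ D : ℝ, D = |totalTrace Y - totalTrace X₀| + |totalTrace Z - totalTrace X₀| :=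
    ⟨_, rfl⟩
  have hD0 : 0 ≤ D := by rw [hD]; positivity
  have hden : 0 < D + 1 := by linarith
  obtain ⟨t, ht⟩ : ∃ t : ℝ, t = 1 / (D + 1) := ⟨_, rfl⟩
  have htpos : 0 < t := by rw [ht]; positivity
  have htle1 : t ≤ 1 := by rw [ht, div_le_one hden]; linarith
  have htd : ∀ d : ℝ, |d| ≤ D → t * d ≤ 1 := by
    intro d hd
    calc t * d ≤ t * (D + 1) := mul_le_mul_of_nonneg_left (by linarith [le_abs_self d]) htpos.le
      _ = 1 := by rw [ht, one_div, inv_mul_cancel₀ hden.ne']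
  have hconvF := convex_blockFeasible A c
  have hmemF : ∀ W ∈ blockFeasible A c, X₀ + t • (W - X₀) ∈ blockFeasible A c := by
    intro W hW
    have h := hconvF hX₀F hW (sub_nonneg.mpr htle1) htpos.le (by ring)
    convert h using 1
    module
  have htrace : ∀ W, totalTrace (X₀ + t • (W - X₀))
      = totalTrace X₀ + t * (totalTrace W - totalTrace X₀) := by
    intro W
    rw [totalTrace_add, totalTrace_smul, totalTrace_sub]
  have hobjt : ∀ W, blockObj C (X₀ + t • (W - X₀))
      = blockObj C X₀ + t * (blockObj C W - blockObj C X₀) := by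
    intro W
    rw [blockObj_add, blockObj_smul, blockObj_sub]
  -- the shrunk points lie in `K`
  have hmemK : ∀ W ∈ blockFeasible A c, blockObj C W = blockObj C X₀ →
      |totalTrace W - totalTrace X₀| ≤ D → X₀ + t • (W - X₀) ∈ K := by
    intro W hW hWobj hd
    refine ⟨⟨hmemF W hW, ?_⟩, ?_⟩
    · show blockObj C (X₀ + t • (W - X₀)) ≤ blockObj C S₀
      rw [hobjt W, hWobj, sub_self, mul_zero, add_zero]
      exact hX₀K.1.2
    · show totalTrace (X₀ + t • (W - X₀)) ≤ T
      rw [htrace W]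
      have := htd _ hd
      linarith
  have hYtK : X₀ + t • (Y - X₀) ∈ K :=
    hmemK Y hY hYobj (by rw [hD]; linarith [abs_nonneg (totalTrace Z - totalTrace X₀)])
  have hZtK : X₀ + t • (Z - X₀) ∈ K :=
    hmemK Z hZ hZobj (by rw [hD]; linarith [abs_nonneg (totalTrace Y - totalTrace X₀)])
  -- `X₀` is the same convex combination of the shrunk points
  have hcombt : a • (X₀ + t • (Y - X₀)) + b • (X₀ + t • (Z - X₀)) = X₀ := by
    have h1 : a • Y + b • Z = (a + b) • X₀ := by rw [hcomb, hab, one_smul]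
    calc a • (X₀ + t • (Y - X₀)) + b • (X₀ + t • (Z - X₀))
        = (a + b) • X₀ + t • ((a • Y + b • Z) - (a + b) • X₀) := by module
      _ = X₀ := by rw [h1, sub_self, smul_zero, add_zero, hab, one_smul]
  -- both shrunk points are trace-minimal over `K`, hence lie in `G`
  have htrcomb : totalTrace X₀
      = a * totalTrace (X₀ + t • (Y - X₀)) + b * totalTrace (X₀ + t • (Z - X₀)) := by
    conv_lhs => rw [← hcombt]
    rw [totalTrace_add, totalTrace_smul, totalTrace_smul]
  have hYttr : totalTrace (X₀ + t • (Y - X₀)) = totalTrace X₀ :=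
    eq_of_convex_comb_of_le ha hb hab htrcomb (hX₀min _ hYtK) (hX₀min _ hZtK)
  have hZttr : totalTrace (X₀ + t • (Z - X₀)) = totalTrace X₀ :=
    eq_of_convex_comb_of_le hb ha (by rw [add_comm]; exact hab) (by rw [htrcomb]; ring)
      (hX₀min _ hZtK) (hX₀min _ hYtK)
  have hYtG : X₀ + t • (Y - X₀) ∈ G :=
    ⟨hYtK, show totalTrace (X₀ + t • (Y - X₀)) ≤ totalTrace S₁ by rw [hYttr]; exact hX₀S₁⟩
  have hZtG : X₀ + t • (Z - X₀) ∈ G :=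
    ⟨hZtK, show totalTrace (X₀ + t • (Z - X₀)) ≤ totalTrace S₁ by rw [hZttr]; exact hX₀S₁⟩
  -- extremality of `X₀` in `G`, then unshrink
  have hsegt : X₀ ∈ openSegment ℝ (X₀ + t • (Y - X₀)) (X₀ + t • (Z - X₀)) :=
    ⟨a, b, ha, hb, hab, hcombt⟩
  have hYteq : X₀ + t • (Y - X₀) = X₀ := (mem_extremePoints_iff_left.mp hX₀).2 _ hYtG _ hZtG hsegt
  have htY : t • (Y - X₀) = 0 := by
    have h : X₀ + t • (Y - X₀) = X₀ + 0 := by rw [hYteq, add_zero]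
    exact add_left_cancel h
  rcases smul_eq_zero.mp htY with h | h
  · exact absurd h htpos.ne'
  · exact sub_eq_zero.mp h

/-- Consequently (Pataki's bound AT AN OPTIMAL SOLUTION — Burer–Monteiro 2003 Thm. 1 in block form): if
the minimum of a linear objective over the block feasible set is attained, it is attained by some feasible
`S` with `Σ_ρ t(rank S_ρ) ≤ |κ|`. [cite: BurerMonteiro2003, §3 Thm. 1 (p. 333)]
[cite: Pataki1998, §2 Thm. 2.2] -/
theorem exists_isMinOn_sum_tri_rank_le [Fintype κ] [∀ ρ, DecidableEq (nρ ρ)]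
    {A : κ → ∀ ρ, Matrix (nρ ρ) (nρ ρ) ℝ} {c : κ → ℝ} (C : ∀ ρ, Matrix (nρ ρ) (nρ ρ) ℝ)
    (hatt : ∃ S ∈ blockFeasible A c, ∀ S' ∈ blockFeasible A c, blockObj C S ≤ blockObj C S') :
    ∃ S ∈ blockFeasible A c, (∀ S' ∈ blockFeasible A c, blockObj C S ≤ blockObj C S') ∧
      ∑ ρ, tri ((S ρ).rank) ≤ Fintype.card κ := by
  obtain ⟨S, hSext, hSopt⟩ := exists_mem_extremePoints_isMinOn C hatt
  exact ⟨S, hSext.1, hSopt, sum_tri_rank_le_card_of_mem_extremePoints hSext⟩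

/-- The `κ = Fin f` form with `ℕ`-division, matching
`PatakiRankBoundBlocks.sum_rank_mul_succ_div_two_le_of_mem_extremePoints`: an attained minimum is attained
by a feasible `S` with `Σ_ρ rank(S_ρ)(rank(S_ρ)+1)/2 ≤ f`. [cite: BurerMonteiro2003, §3 Thm. 1 (p. 333)]
[cite: Pataki1998, §2 Thm. 2.2] -/
theorem exists_isMinOn_sum_rank_mul_succ_div_two_le [∀ ρ, DecidableEq (nρ ρ)] {f : ℕ}
    {A : Fin f → ∀ ρ, Matrix (nρ ρ) (nρ ρ) ℝ} {c : Fin f → ℝ} (C : ∀ ρ, Matrix (nρ ρ) (nρ ρ) ℝ)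
    (hatt : ∃ S ∈ blockFeasible A c, ∀ S' ∈ blockFeasible A c, blockObj C S ≤ blockObj C S') :
    ∃ S ∈ blockFeasible A c, (∀ S' ∈ blockFeasible A c, blockObj C S ≤ blockObj C S') ∧
      ∑ ρ, (S ρ).rank * ((S ρ).rank + 1) / 2 ≤ f := by
  obtain ⟨S, hSext, hSopt⟩ := exists_mem_extremePoints_isMinOn C hatt
  exact ⟨S, hSext.1, hSopt, sum_rank_mul_succ_div_two_le_of_mem_extremePoints hSext⟩

end Literature.Computation.Certificates.SDPOptimalExtremePoint
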